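import Summits.CriticalPhenomena.Ising3D.TaylorTableOddHead
import Mathlib.Tactic.Linarith
import Mathlib.Tactic.Positivity
import Mathlib.Tactic.Ring
import HarnessLib

/-!
# The TABLE layer of a derivative certificate, VIII: the odd head cell in REGULARISED form (cells touching the bound)
(cell `pub-ising3x`, seat boot-1 gen 6; gate (g2) — companion of `TaylorTableOddHead`)

HONEST FRAMING: lottery ticket; floor = tightest certified 3D Ising CFT bounds; no exact-solution
claim without a proof.

The mixed blocks of the odd sector have a simple pole at the unitarity bound `b_ℓ` (`½` at `ℓ = 0`,
`ℓ + 1` at `ℓ ≥ 1`; Kos–Poland–Simmons-Duffin 2014 §4), so the Dolan–Osborn coefficients `cₛ, c₊, c₋` of a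
head term are UNBOUNDED on a cell that touches the bound and `oddHead_nonneg_of_kdCheck` (which asks for
rational enclosures of the coefficients themselves) cannot serve the first cell of a spin. The remedy is the
regularised form: the bracket `B(n,j)` is LINEAR in `(cₛ, c₊, c₋)`, so feeding the SAME expression
`oddBracketSumExpr` with enclosures of the REGULARISED coefficients `(Δ - b_ℓ)·cₛ, (Δ - b_ℓ)·c₊, (Δ - b_ℓ)·c₋`
(bounded down to the bound: the pole-normalised tables of `HRCoeffABBoundTables`) evaluates to
`(Δ - b_ℓ) · Σ_{q∈F} (½)^n B(n,j)`, and for `Δ > b_ℓ` its sign is the sign of the head sum.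
`oddHead_nonneg_of_kdCheck_reg`: same data and the same kd-tree check as the plain theorem, enclosure
hypothesis on `oddCoeffsReg`, conclusion for `b_ℓ < Δ` (the hypothesis `of_oddCover` hands to head cells).
Sources: Kos–Poland–Simmons-Duffin 2014 §3.3 eq. (3.16), §4; Dolan–Osborn 2004 §3. Elementary.
-/

namespace Summit.CriticalPhenomena.Ising3D

open Finset Set
open Literature.MathematicalPhysics.QuantumFieldTheory.ConformalBootstrap3D
open Literature.Analysis.ValidatedNumerics

/-- The regularised coefficient triple `(Δ - b_ℓ) · (cₛ, c₊, c₋)`. [folklore] -/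
noncomputable def oddCoeffsReg (Δσ Δε Δ : ℝ) (ℓ : ℕ) (q : ℕ × ℕ) : ℝ × ℝ × ℝ :=
  ((Δ - unitarityBound3D ℓ) * (oddCoeffs Δσ Δε Δ ℓ q).1,
    (Δ - unitarityBound3D ℓ) * (oddCoeffs Δσ Δε Δ ℓ q).2.1,
    (Δ - unitarityBound3D ℓ) * (oddCoeffs Δσ Δε Δ ℓ q).2.2)

/-- The regularised head point: as `oddHeadPoint` with the regularised coefficient values. [folklore] -/
noncomputable def oddHeadPointReg (ℓ : ℕ) (F : List (ℕ × ℕ)) (Δσ Δε Δ : ℝ) : ℕ → ℝ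
  | 0 => Δσ
  | 1 => Δε
  | 2 => Δ
  | 3 => (1 / 2 : ℝ) ^ (Δε - Δσ)
  | 4 => (1 / 2 : ℝ) ^ (-(2 * Δσ))
  | 5 => (1 / 2 : ℝ) ^ (-(2 * Δε))
  | n + 6 => (flat3 (F.map (oddCoeffsReg Δσ Δε Δ ℓ))).getD n 0

/-- The head variables hold the regularised coefficient values. [folklore] -/
theorem oddHeadPointReg_vars (ℓ : ℕ) (F : List (ℕ × ℕ)) (Δσ Δε Δ : ℝ) (i : ℕ) (q : ℕ × ℕ)
    (h : F[i]? = some q) :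
    oddHeadPointReg ℓ F Δσ Δε Δ (6 + 3 * i) = (oddCoeffsReg Δσ Δε Δ ℓ q).1 ∧
      oddHeadPointReg ℓ F Δσ Δε Δ (6 + 3 * i + 1) = (oddCoeffsReg Δσ Δε Δ ℓ q).2.1 ∧
      oddHeadPointReg ℓ F Δσ Δε Δ (6 + 3 * i + 2) = (oddCoeffsReg Δσ Δε Δ ℓ q).2.2 := by
  have hm : (F.map (oddCoeffsReg Δσ Δε Δ ℓ))[i]? = some (oddCoeffsReg Δσ Δε Δ ℓ q) := by
    rw [List.getElem?_map, h]; rfl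
  obtain ⟨h1, h2, h3⟩ := getD_flat3 (0 : ℝ) _ i _ hm
  refine ⟨?_, ?_, ?_⟩
  · rw [show 6 + 3 * i = 3 * i + 6 by ring]; simpa [oddHeadPointReg] using h1
  · rw [show 6 + 3 * i + 1 = (3 * i + 1) + 6 by ring]; simpa [oddHeadPointReg] using h2
  · rw [show 6 + 3 * i + 2 = (3 * i + 2) + 6 by ring]; simpa [oddHeadPointReg] using h3

/-- Evaluation of one bracket term at the regularised point: `(Δ - b_ℓ) · ((½)^n B(n,j))`. [folklore] -/
theorem eval_oddBracketTermExpr_reg (c : Fin 5 → ℕ × ℕ → ℚ) {L : List (ℕ × ℕ)} (hL : L.Nodup)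
    (ψ : ℕ × ℕ → ℚ) {Lψ : List (ℕ × ℕ)} (hLψ : Lψ.Nodup) (κ₀ : ℚ) (ℓ : ℕ) (F : List (ℕ × ℕ))
    (Δσ Δε Δ : ℝ) (i : ℕ) (q : ℕ × ℕ) (h : F[i]? = some q) :
    (oddBracketTermExpr c L ψ Lψ κ₀ ℓ (6 + 3 * i) q).eval (oddHeadPointReg ℓ F Δσ Δε Δ) =
      (Δ - unitarityBound3D ℓ) * ((1 / 2 : ℝ) ^ q.1 *
        oddConeHeadBracket L.toFinset (fun k ab => (c k ab : ℝ)) Lψ.toFinset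
          (fun ab => (ψ ab : ℝ)) κ₀ Δσ Δε Δ ℓ q) := by
  obtain ⟨h1, h2, h3⟩ := oddHeadPointReg_vars ℓ F Δσ Δε Δ i q h
  simp only [oddBracketTermExpr, ArithExpr.eval_mul, ArithExpr.eval_add, ArithExpr.eval_sub,
    ArithExpr.eval_const, ArithExpr.eval_var, eval_qSumExpr _ _ hL, eval_qSumExpr _ _ hLψ, h1, h2, h3]
  simp only [oddHeadPointReg, oddCoeffsReg, oddCoeffs, oddConeHeadBracket]
  push_cast
  simp only [one_div, inv_pow]
  ring

/-- **Evaluation of the bracket sum at the regularised point**: `(Δ - b_ℓ) · Σ_{q∈F} (½)^n B(n,j)`. [folklore] -/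
theorem eval_oddBracketSumExpr_reg (c : Fin 5 → ℕ × ℕ → ℚ) {L : List (ℕ × ℕ)} (hL : L.Nodup)
    (ψ : ℕ × ℕ → ℚ) {Lψ : List (ℕ × ℕ)} (hLψ : Lψ.Nodup) (κ₀ : ℚ) (ℓ : ℕ) (F : List (ℕ × ℕ))
    (Δσ Δε Δ : ℝ) :
    (oddBracketSumExpr c L ψ Lψ κ₀ ℓ F).eval (oddHeadPointReg ℓ F Δσ Δε Δ) =
      (Δ - unitarityBound3D ℓ) * (F.map fun q => (1 / 2 : ℝ) ^ q.1 *
        oddConeHeadBracket L.toFinset (fun k ab => (c k ab : ℝ)) Lψ.toFinset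
          (fun ab => (ψ ab : ℝ)) κ₀ Δσ Δε Δ ℓ q).sum := by
  rw [oddBracketSumExpr, eval_headSum3Expr _ _ _ 6 F fun i q hq =>
    eval_oddBracketTermExpr_reg c hL ψ hLψ κ₀ ℓ F Δσ Δε Δ i q hq, ← List.sum_map_mul_left]

/-- **TABLE THEOREM, odd head cell, REGULARISED form** (cells down to the unitarity bound). Same data and
kd-tree check as `oddHead_nonneg_of_kdCheck`; the per-term enclosures now enclose the regularised triple
`(Δ - b_ℓ)(cₛ, c₊, c₋)` on box × cell; conclusion for `b_ℓ < Δ`.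
[cite: KosPolandSimmonsduffin2014, §3.3 eq. (3.16)] -/
theorem oddHead_nonneg_of_kdCheck_reg (c : Fin 5 → ℕ × ℕ → ℚ) {L : List (ℕ × ℕ)} (hL : L.Nodup)
    (ψ : ℕ × ℕ → ℚ) {Lψ : List (ℕ × ℕ)} (hLψ : Lψ.Nodup) (κ₀ : ℚ) (ℓ : ℕ)
    {F : List (ℕ × ℕ)} (hF : F.Nodup) (hFj : ∀ q ∈ F, q.2 ≤ ℓ + q.1)
    {σlo σhi εlo εhi lo hi : ℚ} (hℓlo : (ℓ : ℚ) ≤ lo)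
    {r₁ r₂ klo khi : ℚ} (hkhi : 0 < khi) (hr₁ : r₁ ≤ εlo - σhi) (hr₂ : εhi - σlo ≤ r₂)
    (hk₁ : klo ^ r₂.den ≤ (1 / 2 : ℚ) ^ (r₂.num : ℤ)) (hk₂ : (1 / 2 : ℚ) ^ (r₁.num : ℤ) ≤ khi ^ r₁.den)
    {u₁ u₂ mσlo mσhi : ℚ} (hmσhi : 0 < mσhi) (hu₁ : u₁ ≤ -(2 * σhi)) (hu₂ : -(2 * σlo) ≤ u₂)
    (hmσ₁ : mσlo ^ u₂.den ≤ (1 / 2 : ℚ) ^ (u₂.num : ℤ)) (hmσ₂ : (1 / 2 : ℚ) ^ (u₁.num : ℤ) ≤ mσhi ^ u₁.den)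
    {v₁ v₂ mεlo mεhi : ℚ} (hmεhi : 0 < mεhi) (hv₁ : v₁ ≤ -(2 * εhi)) (hv₂ : -(2 * εlo) ≤ v₂)
    (hmε₁ : mεlo ^ v₂.den ≤ (1 / 2 : ℚ) ^ (v₂.num : ℤ)) (hmε₂ : (1 / 2 : ℚ) ^ (v₁.num : ℤ) ≤ mεhi ^ v₁.den)
    {A : List ((ℚ × ℚ) × (ℚ × ℚ) × (ℚ × ℚ))} (hA : A.length = F.length)
    (henc : ∀ p ∈ Icc (σlo : ℝ) σhi ×ˢ Icc (εlo : ℝ) εhi, ∀ Δ : ℝ, (lo : ℝ) ≤ Δ → Δ ≤ hi →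
      ∀ (i : ℕ) (q : ℕ × ℕ) (I : (ℚ × ℚ) × (ℚ × ℚ) × (ℚ × ℚ)), F[i]? = some q → A[i]? = some I →
        ((I.1.1 : ℝ) ≤ (oddCoeffsReg p.1 p.2 Δ ℓ q).1 ∧ (oddCoeffsReg p.1 p.2 Δ ℓ q).1 ≤ (I.1.2 : ℝ)) ∧
        ((I.2.1.1 : ℝ) ≤ (oddCoeffsReg p.1 p.2 Δ ℓ q).2.1 ∧ (oddCoeffsReg p.1 p.2 Δ ℓ q).2.1 ≤ (I.2.1.2 : ℝ)) ∧
        ((I.2.2.1 : ℝ) ≤ (oddCoeffsReg p.1 p.2 Δ ℓ q).2.2 ∧ (oddCoeffsReg p.1 p.2 Δ ℓ q).2.2 ≤ (I.2.2.2 : ℝ)))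
    {t : KdCert ℕ}
    (ht : t.check (exprLeOn (.neg (oddBracketSumExpr c L ψ Lψ κ₀ ℓ F)) 0)
      (oddHeadBox σlo σhi εlo εhi lo hi klo khi mσlo mσhi mεlo mεhi A) = true) :
    ∀ p ∈ Icc (σlo : ℝ) σhi ×ˢ Icc (εlo : ℝ) εhi, ∀ Δ : ℝ, (lo : ℝ) ≤ Δ → Δ ≤ hi → unitarityBound3D ℓ < Δ →
      0 ≤ ∑ q ∈ F.toFinset, oddConeHeadValue (taylorCrossing (1 / 2) (1 / 2) L.toFinset (fun k ab => (c k ab : ℝ)))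
        (∑ ab ∈ Lψ.toFinset, (ψ ab : ℝ) • taylorCoeffAt (1 / 2) (1 / 2) ab) κ₀ p.1 p.2 Δ ℓ q := by
  intro p hp Δ hlo hhi hbΔ
  obtain ⟨⟨hσ1, hσ2⟩, ⟨hε1, hε2⟩⟩ := hp
  have hℓΔ : (ℓ : ℝ) ≤ Δ := by
    have : ((ℓ : ℚ) : ℝ) ≤ (lo : ℝ) := by exact_mod_cast hℓlo
    push_cast at this
    linarith
  have hr₁' : (r₁ : ℝ) ≤ (εlo : ℝ) - (σhi : ℝ) := by exact_mod_cast hr₁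
  have hr₂' : (εhi : ℝ) - (σlo : ℝ) ≤ (r₂ : ℝ) := by exact_mod_cast hr₂
  have hκ := half_rpow_mem_of_checks hkhi hk₁ hk₂ (t := p.2 - p.1) (by linarith) (by linarith)
  have hu₁' : (u₁ : ℝ) ≤ -(2 * (σhi : ℝ)) := by exact_mod_cast hu₁
  have hu₂' : -(2 * (σlo : ℝ)) ≤ (u₂ : ℝ) := by exact_mod_cast hu₂
  have hμσ := half_rpow_mem_of_checks hmσhi hmσ₁ hmσ₂ (t := -(2 * p.1)) (by linarith) (by linarith)
  have hv₁' : (v₁ : ℝ) ≤ -(2 * (εhi : ℝ)) := by exact_mod_cast hv₁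
  have hv₂' : -(2 * (εlo : ℝ)) ≤ (v₂ : ℝ) := by exact_mod_cast hv₂
  have hμε := half_rpow_mem_of_checks hmεhi hmε₁ hmε₂ (t := -(2 * p.2)) (by linarith) (by linarith)
  have hmem : (oddHeadBox σlo σhi εlo εhi lo hi klo khi mσlo mσhi mεlo mεhi A).mem
      (oddHeadPointReg ℓ F p.1 p.2 Δ) := by
    intro n
    match n with
    | 0 => exact ⟨hσ1, hσ2⟩
    | 1 => exact ⟨hε1, hε2⟩
    | 2 => exact ⟨hlo, hhi⟩
    | 3 => exact hκ
    | 4 => exact hμσ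
    | 5 => exact hμε
    | m + 6 =>
      simp only [oddHeadBox, Box.ivl, List.getD_cons_succ]
      by_cases hm : m < 3 * F.length
      · obtain ⟨i, r, hi, hr, rfl⟩ := exists_eq_three_mul_add _ _ hm
        obtain ⟨q, hq⟩ : ∃ q, F[i]? = some q := ⟨F[i], List.getElem?_eq_getElem hi⟩
        have hiA : i < A.length := hA ▸ hi
        have hI : A[i]? = some A[i] := List.getElem?_eq_getElem hiA
        obtain ⟨e1, e2, e3⟩ := henc p ⟨⟨hσ1, hσ2⟩, ⟨hε1, hε2⟩⟩ Δ hlo hhi i q _ hq hI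
        obtain ⟨b1, b2, b3⟩ := getD_flat3 ((0 : ℚ), (0 : ℚ)) A i _ hI
        obtain ⟨v1, v2, v3⟩ := oddHeadPointReg_vars ℓ F p.1 p.2 Δ i q hq
        interval_cases r
        · rw [Nat.add_zero, b1, show 3 * i + 6 = 6 + 3 * i by ring, v1]; exact e1
        · rw [b2, show 3 * i + 1 + 6 = 6 + 3 * i + 1 by ring, v2]; exact e2
        · rw [b3, show 3 * i + 2 + 6 = 6 + 3 * i + 2 by ring, v3]; exact e3
      · rw [getD_flat3_of_le _ A m (by rw [hA]; omega)]
        simp only [oddHeadPointReg]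
        rw [getD_flat3_of_le _ _ m (by simpa using not_lt.mp hm)]
        simp
  have h := nonneg_of_kdCheck_neg ht _ hmem
  rw [eval_oddBracketSumExpr_reg c hL ψ hLψ κ₀ ℓ F] at h
  have hx : 0 < Δ - unitarityBound3D ℓ := sub_pos.mpr hbΔ
  have h' := (mul_nonneg_iff_of_pos_left hx).mp h
  have hFj' : ∀ q ∈ F.toFinset, (q.2 : ℝ) ≤ Δ + (q.1 : ℝ) := by
    intro q hq
    have h1 : q.2 ≤ ℓ + q.1 := hFj q (List.mem_toFinset.mp hq)
    have : (q.2 : ℝ) ≤ (ℓ : ℝ) + (q.1 : ℝ) := by exact_mod_cast h1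
    linarith
  rw [sum_oddConeHeadValue_half_nonneg_iff _ _ _ _ _ _ _ _ _ _ hFj', List.sum_toFinset _ hF]
  simpa [Real.rpow_natCast] using h'

end Summit.CriticalPhenomena.Ising3D
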